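import Mathlib
import Summits.NavierStokesRegularity.OSWSelfSimilar.SheetNSLineTorusCascadeCellCheckerSound
import HarnessLib

/-!
# Viscous CLM on the torus (`a = 0`, `σ = 2`): soundness of the reflective cell-chain checker — decay brackets, the state
# invariant, one cell and one segment

HONEST FRAMING (cell ns-blowup GROUP B «PROFILE SEARCH», zone Z3, row Z3-U addendum A-F2 of `HOME/profile/z3/CENSUS-Z3.md`;
human rulings D-0035/D-0074; Z3-TWIN lineage, eng-5 g13): **1-D MODEL (viscous Constantin–Lax–Majda equation `ω_t = ω Hω + ν ω_xx`
on `𝕋`); natural-number arithmetic + ODE comparison, kernel-checked; not Euler, not Navier–Stokes; «violates: none — MODEL».**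

* generic facts on the indexed list predicates `IForall` / `IForall₂` (monotonicity, `zipMax` / `zipMin`, indexed read-out);
* `rhos_sound` — `CellChain.rhos` brackets the exact dyadic decay weights (`exp_neg_mul_log_dyadic`);
* `runSeg_sound` — the invariant (mode-1 bracket, grid bounds, running suprema on `[0, t]`, running window infima) survives a segment;
* `Inv` — the state invariant (mode-1 bracket, grid bounds, running suprema on `[0, t]`, time bookkeeping, window infima);
  `cell_sound` — one cell preserves it. The run for a bracketed real datum, the ray and the user-facing theorem `runB_sound` are
  in `SheetNSLineTorusCascadeCellCheckerMain`.
bears_on: LADDER-NS N5 / zone Z3 (row Z3-U) → N1 linear core. WHAT THIS IS NOT: not NS; no number certified by THIS file.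
-/

namespace Summit.NavierStokesRegularity.OSWSelfSimilar
namespace SheetNSLineTorusCascade
namespace CellChain

open Finset Real Set

/-! ### Generic facts on the indexed list predicates -/

/-- Monotonicity of `IForall` in the predicate. [folklore] -/
theorem IForall.mono {P Q : ℕ → ℕ → Prop} (h : ∀ k x, P k x → Q k x) :
    ∀ (L : List ℕ) (k : ℕ), IForall P k L → IForall Q k L
  | [], _, _ => trivial
  | _ :: xs, k, hx => ⟨h k _ hx.1, IForall.mono h xs (k + 1) hx.2⟩

/-- `IForall₂` forces equal lengths. [folklore] -/
theorem IForall₂.length_eq {P : ℕ → ℕ → ℕ → Prop} :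
    ∀ (xs ys : List ℕ) (k : ℕ), IForall₂ P k xs ys → xs.length = ys.length
  | [], [], _, _ => rfl
  | [], _ :: _, _, h => absurd h id
  | _ :: _, [], _, h => absurd h id
  | _ :: xs, _ :: ys, k, h => by simp [IForall₂.length_eq xs ys (k + 1) h.2]

/-- Projection of `IForall₂` to its first list. [folklore] -/
theorem IForall₂.fst {P : ℕ → ℕ → ℕ → Prop} {Q : ℕ → ℕ → Prop} (h : ∀ k x y, P k x y → Q k x) :
    ∀ (xs ys : List ℕ) (k : ℕ), IForall₂ P k xs ys → IForall Q k xs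
  | [], [], _, _ => trivial
  | [], _ :: _, _, hP => absurd hP id
  | _ :: _, [], _, hP => absurd hP id
  | _ :: xs, _ :: ys, k, hP => ⟨h k _ _ hP.1, IForall₂.fst h xs ys (k + 1) hP.2⟩

/-- Projection of `IForall₂` to its second list. [folklore] -/
theorem IForall₂.snd {P : ℕ → ℕ → ℕ → Prop} {Q : ℕ → ℕ → Prop} (h : ∀ k x y, P k x y → Q k y) :
    ∀ (xs ys : List ℕ) (k : ℕ), IForall₂ P k xs ys → IForall Q k ys
  | [], [], _, _ => trivial
  | [], _ :: _, _, hP => absurd hP id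
  | _ :: _, [], _, hP => absurd hP id
  | _ :: xs, _ :: ys, k, hP => ⟨h k _ _ hP.1, IForall₂.snd h xs ys (k + 1) hP.2⟩

/-- `zipMax` combines two `IForall`s. [folklore] -/
theorem IForall.zipMax {P Q R : ℕ → ℕ → Prop} (h : ∀ k x y, P k x → Q k y → R k (max x y)) :
    ∀ (xs ys : List ℕ) (k : ℕ), IForall P k xs → IForall Q k ys → xs.length = ys.length →
      IForall R k (zipMax xs ys) ∧ (zipMax xs ys).length = xs.length
  | [], [], _, _, _, _ => ⟨trivial, rfl⟩
  | [], _ :: _, _, _, _, hl => by simp at hl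
  | _ :: _, [], _, _, _, hl => by simp at hl
  | _ :: xs, _ :: ys, k, hP, hQ, hl => by
    have ih := IForall.zipMax h xs ys (k + 1) hP.2 hQ.2 (by simpa using hl)
    exact ⟨⟨h k _ _ hP.1 hQ.1, ih.1⟩, by simp [CellChain.zipMax, ih.2]⟩

/-- `zipMin` combines two `IForall`s. [folklore] -/
theorem IForall.zipMin {P Q R : ℕ → ℕ → Prop} (h : ∀ k x y, P k x → Q k y → R k (min x y)) :
    ∀ (xs ys : List ℕ) (k : ℕ), IForall P k xs → IForall Q k ys → xs.length = ys.length →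
      IForall R k (zipMin xs ys) ∧ (zipMin xs ys).length = xs.length
  | [], [], _, _, _, _ => ⟨trivial, rfl⟩
  | [], _ :: _, _, _, _, hl => by simp at hl
  | _ :: _, [], _, _, _, hl => by simp at hl
  | _ :: xs, _ :: ys, k, hP, hQ, hl => by
    have ih := IForall.zipMin h xs ys (k + 1) hP.2 hQ.2 (by simpa using hl)
    exact ⟨⟨h k _ _ hP.1 hQ.1, ih.1⟩, by simp [CellChain.zipMin, ih.2]⟩

/-- Indexed read-out of `IForall`. [folklore] -/
theorem IForall.getD {P : ℕ → ℕ → Prop} :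
    ∀ (L : List ℕ) (k : ℕ), IForall P k L → ∀ i, i < L.length → P (k + i) (L.getD i 0)
  | [], _, _, i, hi => by simp at hi
  | x :: xs, k, h, 0, _ => by simpa using h.1
  | x :: xs, k, h, i + 1, hi => by
    have := IForall.getD xs (k + 1) h.2 i (by simpa using hi)
    simpa [Nat.add_assoc, Nat.add_comm 1 i] using this

/-- The trivially true `IForall` on `zeros`/`consts`. [folklore] -/
theorem IForall_of_forall {P : ℕ → ℕ → Prop} {B : ℕ} (h : ∀ k, P k B) : ∀ (n k : ℕ), IForall P k (consts B n)
  | 0, _ => trivial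
  | n + 1, k => ⟨h k, IForall_of_forall h n (k + 1)⟩

/-- Length of a constant list. [folklore] -/
theorem length_consts (B : ℕ) : ∀ n, (consts B n).length = n
  | 0 => rfl
  | n + 1 => by simp [consts, length_consts B n]

/-- `zeros` is `consts 0`. [folklore] -/
theorem zeros_eq_consts : ∀ n, zeros n = consts 0 n
  | 0 => rfl
  | n + 1 => by simp [zeros, consts, zeros_eq_consts n]

/-- Length of the decay table. [folklore] -/
theorem length_rhos (P a j : ℕ) : ∀ n k, (rhos P a j n k).length = n
  | 0, _ => rfl
  | n + 1, k => by simp [rhos, length_rhos P a j n (k + 1)]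

/-! ### The decay brackets -/

/-- **`rhos` is honest.** For `0 < a < 2^j` and `δ = log(2^j/a)`: every entry `ρ` (mode `k ≥ 1`) satisfies
`ρ/2^P ≤ e^{−k²δ} ≤ (ρ+1)/2^P` and `ρ + 1 ≤ 2^P`. [new here — MODEL] -/
theorem rhos_sound (P : ℕ) {a j : ℕ} (ha : 0 < a) (haj : a < 2 ^ j) (t : ℝ) :
    ∀ (n k : ℕ), 1 ≤ k → RhoOK (2 ^ P) t (t + Real.log (2 ^ j / a)) k (rhos P a j n k)
  | 0, _, _ => trivial
  | n + 1, k, hk => by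
    refine ⟨?_, rhos_sound P ha haj t n (k + 1) (by omega)⟩
    have har : (0 : ℝ) < a := by exact_mod_cast ha
    have h2j : (0 : ℝ) < 2 ^ j := by positivity
    have hDr : (0 : ℝ) < ((2 ^ P : ℕ) : ℝ) := by positivity
    -- the exact weight
    have hw : exp (-(1 * (k : ℝ) ^ 2 * (t + Real.log (2 ^ j / a) - t))) = ((a : ℝ) / 2 ^ j) ^ (k * k) := by
      rw [← exp_neg_mul_log_dyadic (k * k) har j]
      congr 1; push_cast; ring
    -- the floor
    set ρ : ℕ := (a ^ (k * k)) <<< P >>> (j * k * k) with hρ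
    have hρdef : ρ = a ^ (k * k) * 2 ^ P / 2 ^ (j * k * k) := by
      rw [hρ, Nat.shiftRight_eq_div_pow, Nat.shiftLeft_eq]
    have hb : 0 < 2 ^ (j * k * k) := by positivity
    have hlo : ρ * 2 ^ (j * k * k) ≤ a ^ (k * k) * 2 ^ P := by rw [hρdef]; exact Nat.div_mul_le_self _ _
    have hhi : a ^ (k * k) * 2 ^ P < (ρ + 1) * 2 ^ (j * k * k) := by
      rw [hρdef, add_mul, one_mul]; exact Nat.lt_div_mul_add hb
    have hbr : (0 : ℝ) < ((2 ^ (j * k * k) : ℕ) : ℝ) := by positivity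
    have hq : ((a : ℝ) / 2 ^ j) ^ (k * k) = ((a ^ (k * k) : ℕ) : ℝ) / ((2 ^ (j * k * k) : ℕ) : ℝ) := by
      push_cast
      rw [div_pow, ← pow_mul, show j * k * k = j * (k * k) by ring]
    have hlo' : (ρ : ℝ) * ((2 ^ (j * k * k) : ℕ) : ℝ) ≤ ((a ^ (k * k) : ℕ) : ℝ) * ((2 ^ P : ℕ) : ℝ) := by
      exact_mod_cast hlo
    have hhi' : ((a ^ (k * k) : ℕ) : ℝ) * ((2 ^ P : ℕ) : ℝ) < ((ρ : ℝ) + 1) * ((2 ^ (j * k * k) : ℕ) : ℝ) := by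
      exact_mod_cast hhi
    refine ⟨?_, ?_, ?_⟩
    · rw [hw, hq, div_le_iff₀ hDr, div_mul_eq_mul_div, le_div_iff₀ hbr]
      exact hlo'
    · rw [hw, hq, div_le_iff₀ hbr, div_mul_eq_mul_div, le_div_iff₀ hDr]
      exact hhi'.le
    · -- ρ < 2^P since q^{k²} < 1
      have hq1 : ((a : ℝ) / 2 ^ j) ^ (k * k) < 1 := by
        apply pow_lt_one₀ (by positivity) ((div_lt_one h2j).mpr (by exact_mod_cast haj))
        exact Nat.mul_ne_zero (by omega) (by omega)
      rw [hq, div_lt_one hbr] at hq1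
      have hρlt : (ρ : ℝ) < ((2 ^ P : ℕ) : ℝ) := by nlinarith
      have : ρ < 2 ^ P := by exact_mod_cast hρlt
      omega

/-! ### One cell of a segment, and a segment -/

section Run

variable {c : ℝ} {e : ℕ → ℝ → ℝ}

/-- The state invariant at grid time `t` (first-segment cell length `δ₁`, window cells `w₁ ≤ idx < w₂`): mode-`1` bracket, grid
bounds and lengths, running suprema on `[0, t]`, time bookkeeping, and the window infima collected so far. [new here — MODEL] -/
structure Inv (e : ℕ → ℝ → ℝ) (c : ℝ) (P K w₁ w₂ : ℕ) (δ₁ t : ℝ) (st : St) : Prop where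
  /-- time is nonnegative -/
  t0 : 0 ≤ t
  /-- mode-1 lower bracket -/
  xlo : (st.xlo : ℝ) / ((2 ^ P : ℕ) : ℝ) ≤ c * exp (-(1 * t))
  /-- mode-1 upper bracket -/
  xhi : c * exp (-(1 * t)) ≤ (st.xhi : ℝ) / ((2 ^ P : ℕ) : ℝ)
  /-- grid bounds of the modes `2…K` -/
  heads : Heads e (2 ^ P) t 2 st.lo st.up
  /-- lengths -/
  lenlo : st.lo.length = K - 1
  /-- running suprema on `[0, t]` -/
  sup : IForall (fun k U => ∀ s ∈ Icc 0 t, e k s ≤ (U : ℝ) / ((2 ^ P : ℕ) : ℝ)) 2 st.usup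
  /-- lengths -/
  lensup : st.usup.length = K - 1
  /-- lengths -/
  leninf : st.linf.length = K - 1
  /-- time bookkeeping: inside the first segment `t = idx·δ₁`; afterwards the window is over -/
  time : t = (st.idx : ℝ) * δ₁ ∨ ((w₂ : ℝ) * δ₁ ≤ t ∧ w₂ ≤ st.idx)
  /-- window infima collected so far -/
  win : w₁ < st.idx →
    IForall (fun k L => ∀ s ∈ Icc ((w₁ : ℝ) * δ₁) (min t ((w₂ : ℝ) * δ₁)), (L : ℝ) / ((2 ^ P : ℕ) : ℝ) ≤ e k s) 2 st.linf

/-- Every entry satisfies a pointwise-true predicate. [folklore] -/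
theorem IForall_of_true {P : ℕ → ℕ → Prop} (h : ∀ k x, P k x) : ∀ (L : List ℕ) (k : ℕ), IForall P k L
  | [], _ => trivial
  | x :: xs, k => ⟨h k x, IForall_of_true h xs (k + 1)⟩

/-- `IForall₂` on two constant lists from a predicate true from `k₀` on. [folklore] -/
theorem IForall₂_consts {P : ℕ → ℕ → ℕ → Prop} {k₀ B B' : ℕ} (h : ∀ k, k₀ ≤ k → P k B B') :
    ∀ (n k : ℕ), k₀ ≤ k → IForall₂ P k (consts B n) (consts B' n)
  | 0, _, _ => trivial
  | n + 1, k, hk => ⟨h k hk, IForall₂_consts h n (k + 1) (by omega)⟩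

/-- `IForall` on a constant list from a predicate true from `k₀` on. [folklore] -/
theorem IForall_consts {P : ℕ → ℕ → Prop} {k₀ B : ℕ} (h : ∀ k, k₀ ≤ k → P k B) :
    ∀ (n k : ℕ), k₀ ≤ k → IForall P k (consts B n)
  | 0, _, _ => trivial
  | n + 1, k, hk => ⟨h k hk, IForall_consts h n (k + 1) (by omega)⟩

/-- The zero table reads zero. [folklore] -/
theorem lget_consts_zero (n a : ℕ) : lget (consts 0 n) a = 0 := by
  unfold lget
  split_ifs with h
  · rfl
  · induction n generalizing a with
    | zero => simp [consts]
    | succ n ih =>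
      rcases Nat.lt_or_ge (a - 1) 1 with h1 | h1
      · have : a - 1 = 0 := by omega
        simp [consts, this]
      · have := ih (a - 1) (by omega)
        rw [show a - 1 = (a - 1 - 1) + 1 by omega]
        simpa [consts] using this

/-- `e^{−(1·(t+δ))} = e^{−(1·t)} · (a/2^j)` for `δ = log(2^j/a)`. [folklore] -/
theorem exp_neg_add_log_dyadic (t : ℝ) {a : ℝ} (ha : 0 < a) (j : ℕ) :
    exp (-(1 * (t + Real.log (2 ^ j / a)))) = exp (-(1 * t)) * (a / 2 ^ j) := by
  have h := exp_neg_mul_log_dyadic 1 ha j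
  simp only [Nat.cast_one, one_mul, pow_one] at h
  rw [← h, ← Real.exp_add]
  congr 1; ring

/-- **One cell preserves the invariant** (cell of length `δ = log(2^j/a)`, `0 < a < 2^j`; first segment `δ = δ₁`, or the window is
already over). [new here — MODEL] -/
theorem cell_sound (he : IsSineCascade 1 c e) (hc : 0 ≤ c) {P K w₁ w₂ : ℕ} (hw : w₁ < w₂) {δ₁ : ℝ} (hδ₁ : 0 ≤ δ₁)
    {a j : ℕ} (ha : 0 < a) (haj : a < 2 ^ j) {t : ℝ} {st : St} (hI : Inv e c P K w₁ w₂ δ₁ t st)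
    (hmode : Real.log (2 ^ j / a) = δ₁ ∨ ((w₂ : ℝ) * δ₁ ≤ t ∧ w₂ ≤ st.idx)) :
    Inv e c P K w₁ w₂ δ₁ (t + Real.log (2 ^ j / a))
      { xlo := (st.xlo * a) >>> j, xhi := cdiv (st.xhi * a) (2 ^ j),
        lo := (cellLoop (2 ^ P) st.lo st.up (rhos P a j (K - 1) 2) 2 [(st.xlo * a) >>> j] [(st.xlo * a) >>> j]
          [st.xhi] [st.xhi]).1,
        up := (cellLoop (2 ^ P) st.lo st.up (rhos P a j (K - 1) 2) 2 [(st.xlo * a) >>> j] [(st.xlo * a) >>> j]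
          [st.xhi] [st.xhi]).2.1,
        usup := zipMax st.usup (cellLoop (2 ^ P) st.lo st.up (rhos P a j (K - 1) 2) 2 [(st.xlo * a) >>> j]
          [(st.xlo * a) >>> j] [st.xhi] [st.xhi]).2.2.2,
        linf := if w₁ ≤ st.idx ∧ st.idx < w₂ then zipMin st.linf (cellLoop (2 ^ P) st.lo st.up (rhos P a j (K - 1) 2) 2
          [(st.xlo * a) >>> j] [(st.xlo * a) >>> j] [st.xhi] [st.xhi]).2.2.1 else st.linf,
        idx := st.idx + 1 } := by
  have har : (0 : ℝ) < a := by exact_mod_cast ha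
  have h2j : (0 : ℝ) < 2 ^ j := by positivity
  have hDr : (0 : ℝ) < ((2 ^ P : ℕ) : ℝ) := by positivity
  have hD : 0 < 2 ^ P := by positivity
  set δ : ℝ := Real.log (2 ^ j / a) with hδ
  have hδ0 : 0 ≤ δ := log_dyadic_nonneg har j (by exact_mod_cast haj.le)
  set xlo' : ℕ := (st.xlo * a) >>> j with hxlo'
  set D : ℕ := 2 ^ P with hDdef
  set r := cellLoop D st.lo st.up (rhos P a j (K - 1) 2) 2 [xlo'] [xlo'] [st.xhi] [st.xhi] with hr
  -- mode 1 at the new grid time and on the cell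
  have hexp : exp (-(1 * (t + δ))) = exp (-(1 * t)) * (a / 2 ^ j) := exp_neg_add_log_dyadic t har j
  have hxlo_new : (xlo' : ℝ) / (D : ℝ) ≤ c * exp (-(1 * (t + δ))) := by
    have h1 : (xlo' : ℝ) ≤ ((st.xlo * a : ℕ) : ℝ) / ((2 ^ j : ℕ) : ℝ) := by
      rw [hxlo', Nat.shiftRight_eq_div_pow]; exact Nat.cast_div_le
    rw [hexp, div_le_iff₀ hDr]
    have h2 := hI.xlo
    rw [div_le_iff₀ hDr] at h2
    push_cast at h1 ⊢
    have h3 : (st.xlo : ℝ) * a / 2 ^ j ≤ c * exp (-(1 * t)) * (D : ℝ) * (a / 2 ^ j) := by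
      rw [mul_div_assoc]
      exact mul_le_mul_of_nonneg_right h2 (by positivity)
    linarith
  have hxhi_new : c * exp (-(1 * (t + δ))) ≤ ((cdiv (st.xhi * a) (2 ^ j) : ℕ) : ℝ) / (D : ℝ) := by
    have h1 : ((st.xhi * a : ℕ) : ℝ) / ((2 ^ j : ℕ) : ℝ) ≤ ((cdiv (st.xhi * a) (2 ^ j) : ℕ) : ℝ) :=
      (cdiv_spec _ (by positivity)).2
    rw [hexp, le_div_iff₀ hDr]
    have h2 := hI.xhi
    rw [le_div_iff₀ hDr] at h2
    push_cast at h1 ⊢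
    have h3 : c * exp (-(1 * t)) * (D : ℝ) * (a / 2 ^ j) ≤ (st.xhi : ℝ) * a / 2 ^ j := by
      rw [mul_div_assoc]
      exact mul_le_mul_of_nonneg_right h2 (by positivity)
    linarith
  have htab : InTab e D t (t + δ) 2 [xlo'] [st.xhi] := by
    refine ⟨rfl, rfl, fun b hb1 hb2 σ hσ => ?_⟩
    obtain rfl : b = 1 := by omega
    have hm := mode_one_bounds he zero_le_one hc hI.t0 hσ
    simp only [lget_succ, List.getD_cons_zero]
    exact ⟨le_trans hxlo_new hm.1, le_trans hm.2 hI.xhi⟩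
  have hlenρ : st.lo.length = (rhos P a j (K - 1) 2).length := by rw [length_rhos, hI.lenlo]
  have hcell := cellLoop_sound he hc hD hI.t0 (by linarith : t ≤ t + δ) st.lo st.up (rhos P a j (K - 1) 2) 2
    [xlo'] [xlo'] [st.xhi] [st.xhi] (by norm_num) rfl rfl htab hI.heads (rhos_sound P ha haj t (K - 1) 2 (by norm_num)) hlenρ
  rw [← hr] at hcell
  obtain ⟨⟨hheads', hcellB⟩, hl1, hl2, hl3, hl4⟩ := hcell
  -- running suprema
  have hsup := IForall.zipMax (P := fun k U => ∀ s ∈ Icc 0 t, e k s ≤ (U : ℝ) / (D : ℝ))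
    (Q := fun k M => ∀ σ ∈ Icc t (t + δ), e k σ ≤ (M : ℝ) / (D : ℝ))
    (R := fun k U => ∀ s ∈ Icc 0 (t + δ), e k s ≤ (U : ℝ) / (D : ℝ))
    (fun k x y hx hy s hs => by
      rw [Nat.cast_max, ← max_div_div_right hDr.le]
      rcases le_total s t with hst | hst
      · exact le_trans (hx s ⟨hs.1, hst⟩) (le_max_left _ _)
      · exact le_trans (hy s ⟨hst, hs.2⟩) (le_max_right _ _))
    st.usup r.2.2.2 2 hI.sup (IForall₂.snd (fun k x y hxy => fun σ hσ => (hxy σ hσ).2) _ _ 2 hcellB)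
    (by rw [hI.lensup, hl4, hI.lenlo])
  -- the window infima
  have hwinP : IForall (fun k L => w₁ < st.idx → ∀ s ∈ Icc ((w₁ : ℝ) * δ₁) (min t ((w₂ : ℝ) * δ₁)),
      (L : ℝ) / (D : ℝ) ≤ e k s) 2 st.linf := by
    by_cases h : w₁ < st.idx
    · exact IForall.mono (fun k L hL => fun _ => hL) _ _ (hI.win h)
    · exact IForall_of_true (fun k L => fun h' => absurd h' h) _ _
  refine ⟨by linarith [hI.t0], hxlo_new, hxhi_new, hheads', by rw [hl1, hI.lenlo], hsup.1,
    by rw [hsup.2, hI.lensup], ?_, ?_, ?_⟩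
  · -- length of linf
    show (if w₁ ≤ st.idx ∧ st.idx < w₂ then zipMin st.linf r.2.2.1 else st.linf).length = K - 1
    split_ifs with hwin
    · rw [(IForall.zipMin (P := fun _ _ => True) (Q := fun _ _ => True) (R := fun _ _ => True) (fun _ _ _ _ _ => trivial)
        st.linf r.2.2.1 2 (IForall_of_true (fun _ _ => trivial) _ _) (IForall_of_true (fun _ _ => trivial) _ _)
        (by rw [hI.leninf, hl3, hI.lenlo])).2, hI.leninf]
    · exact hI.leninf
  · -- time bookkeeping
    show t + δ = ((st.idx + 1 : ℕ) : ℝ) * δ₁ ∨ ((w₂ : ℝ) * δ₁ ≤ t + δ ∧ w₂ ≤ st.idx + 1)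
    rcases hmode with hm | ⟨hm1, hm2⟩
    · rcases hI.time with h | ⟨h1, h2⟩
      · left; rw [h, ← hm]; push_cast; ring
      · right; exact ⟨by linarith, by omega⟩
    · right; exact ⟨by linarith, by omega⟩
  · -- the window
    intro hidx
    change w₁ < st.idx + 1 at hidx
    show IForall (fun k L => ∀ s ∈ Icc ((w₁ : ℝ) * δ₁) (min (t + δ) ((w₂ : ℝ) * δ₁)), (L : ℝ) / (D : ℝ) ≤ e k s) 2
      (if w₁ ≤ st.idx ∧ st.idx < w₂ then zipMin st.linf r.2.2.1 else st.linf)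
    split_ifs with hwin
    · -- a window cell: first segment, t = idx·δ₁
      have htime : t = (st.idx : ℝ) * δ₁ := by
        rcases hI.time with h | ⟨_, h2⟩
        · exact h
        · exact absurd hwin.2 (by omega)
      have hδδ : δ = δ₁ := by
        rcases hmode with hm | ⟨_, hm2⟩
        · exact hm
        · exact absurd hwin.2 (by omega)
      exact (IForall.zipMin (R := fun k L => ∀ s ∈ Icc ((w₁ : ℝ) * δ₁) (min (t + δ) ((w₂ : ℝ) * δ₁)),
          (L : ℝ) / (D : ℝ) ≤ e k s)
        (fun k x y hx hy s hs => by
          rw [Nat.cast_min, ← min_div_div_right hDr.le]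
          rcases le_or_gt t s with hst | hst
          · exact le_trans (min_le_right _ _) (hy s ⟨hst, le_trans hs.2 (min_le_left _ _)⟩)
          · have hlt : w₁ < st.idx := by
              by_contra hcon
              have hEq : st.idx = w₁ := by omega
              have : t = (w₁ : ℝ) * δ₁ := by rw [htime, hEq]
              linarith [hs.1]
            exact le_trans (min_le_left _ _) (hx hlt s ⟨hs.1, le_min (le_of_lt hst) (le_trans hs.2 (min_le_right _ _))⟩))
        st.linf r.2.2.1 2 hwinP (IForall₂.fst (fun k x y hxy => fun σ hσ => (hxy σ hσ).1) _ _ 2 hcellB)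
        (by rw [hI.leninf, hl3, hI.lenlo])).1
    · -- not a window cell: either before the window (vacuous) or after it (window frozen)
      have hafter : w₂ ≤ st.idx := by
        by_contra hcon
        exact hwin ⟨by omega, by omega⟩
      have hT₂ : (w₂ : ℝ) * δ₁ ≤ t := by
        rcases hI.time with h | ⟨h1, _⟩
        · rw [h]; exact mul_le_mul_of_nonneg_right (by exact_mod_cast hafter) hδ₁
        · exact h1
      have hlt : w₁ < st.idx := by omega
      refine IForall.mono (fun k L hL => fun s hs => hL hlt s ⟨hs.1, ?_⟩) _ _ hwinP
      rw [min_eq_right hT₂]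
      exact le_trans hs.2 (min_le_right _ _)

/-- **One segment preserves the invariant** (and counts its cells). [new here — MODEL] -/
theorem runSeg_sound (he : IsSineCascade 1 c e) (hc : 0 ≤ c) {P K w₁ w₂ : ℕ} (hw : w₁ < w₂) {δ₁ : ℝ} (hδ₁ : 0 ≤ δ₁)
    {a j : ℕ} (ha : 0 < a) (haj : a < 2 ^ j) :
    ∀ (n : ℕ) (t : ℝ) (st : St), Inv e c P K w₁ w₂ δ₁ t st →
      (Real.log (2 ^ j / a) = δ₁ ∨ ((w₂ : ℝ) * δ₁ ≤ t ∧ w₂ ≤ st.idx)) →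
      Inv e c P K w₁ w₂ δ₁ (t + n * Real.log (2 ^ j / a)) (runSeg (2 ^ P) a j w₁ w₂ (rhos P a j (K - 1) 2) n st) ∧
        (runSeg (2 ^ P) a j w₁ w₂ (rhos P a j (K - 1) 2) n st).idx = st.idx + n
  | 0, t, st, hI, _ => by simpa [runSeg] using hI
  | n + 1, t, st, hI, hmode => by
    have hcl := cell_sound he hc hw hδ₁ ha haj hI hmode
    have hmode' : Real.log (2 ^ j / a) = δ₁ ∨ ((w₂ : ℝ) * δ₁ ≤ t + Real.log (2 ^ j / a) ∧ w₂ ≤ st.idx + 1) := by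
      rcases hmode with h | ⟨h1, h2⟩
      · exact Or.inl h
      · right
        have har : (0 : ℝ) < a := by exact_mod_cast ha
        exact ⟨by linarith [log_dyadic_nonneg har j (by exact_mod_cast haj.le)], by omega⟩
    have ih := runSeg_sound he hc hw hδ₁ ha haj n (t + Real.log (2 ^ j / a)) _ hcl hmode'
    rw [runSeg]
    refine ⟨?_, by rw [ih.2]; simp only; omega⟩
    have : t + Real.log (2 ^ j / a) + n * Real.log (2 ^ j / a) = t + ((n + 1 : ℕ) : ℝ) * Real.log (2 ^ j / a) := by
      push_cast; ring
    rw [this] at ih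
    exact ih.1

end Run

end CellChain
end SheetNSLineTorusCascade
end Summit.NavierStokesRegularity.OSWSelfSimilar
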